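import Mathlib
import Literature.Analysis.FluidPDE.VectorCalculus
import Literature.Analysis.FluidPDE.Vorticity
import Literature.Analysis.FluidPDE.CurlFreeLiouville
import Literature.Analysis.FluidPDE.SteadyNSClassicalRegularity
import Literature.Analysis.FluidPDE.NSLocalLerayBackwardUniqueness
import Summits.NavierStokesRegularity.NavierStokesRegularity.Theses.ThreadingFlux
import Summits.NavierStokesRegularity.NavierStokesRegularity.Theorems.ThreadingFluxCentreJetDefs
import Summits.NavierStokesRegularity.NavierStokesRegularity.Theorems.ThreadingFluxCentreJetRigidityReductionSharp
import Summits.NavierStokesRegularity.NavierStokesRegularity.Theorems.ThreadingFluxPlatonicDefs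
import HarnessLib

/-!
# Crux `PoloidalLiouville` (stmt-NavierStokesRegularity-1222, wall W1), crux idea «platonic-germ-sieve» (ns-idea-15 g11, V27):
# the steady O-stratum — `IrrotationalGermLiouville` BY NAME, and the sieve's conjecture ALONE decides the steady octahedral stratum

Support file (Theorems-side; seat ns-wall-eng-8 g6, cell `ns-wall-extremal`, W1 adjunct; `--supports stmt-NavierStokesRegularity-1222
--as helper`; 0 kit), over the Defs twin `ThreadingFluxPlatonicDefs.lean` of the sketch `Cruxes/PoloidalLiouville/PlatonicSketch.lean`.

1. ★ `Platonic.irrotationalGermLiouville : IrrotationalGermLiouville` — the card's second «classical fact» hypothesis is a TREE THEOREM as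
   typed: the statement quantifies over BOUNDED classical steady flows on all of `ℝ³` (the sketch's `C²/C¹` class on `univ` is exactly
   the tree's `Literature.Analysis.FluidPDE.IsSteadyNSSolution 1 0`), and those are real-analytic (`IsSteadyNSSolution.analyticOnNhd_of_bounded`:
   Oseen-mild + the local analytic Oseen solution); the vorticity is analytic and vanishes on an open ball, hence everywhere
   (`curl_eq_zero_of_eqOn_open`, identity theorem on the connected `ℝ³`), and a bounded `C²` field with `curl V = 0`, `div V = 0` is
   constant (`eq_of_curl_eq_zero_of_isDivFree_of_bounded`, KNSS 2009 Lemma 3.1: bounded harmonic coordinates).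
2. ★ `Platonic.symmetricSteadyLiouville_octahedral_of_centreRigidity : OctahedralCentreRigidity → SymmetricSteadyLiouville octahedral` —
   the sketch's rung `octahedralSteadyLiouville_of_centreRigidity (hA : SteadyNSAnalytic) (hL : IrrotationalGermLiouville) (hR : …)` with
   BOTH classical hypotheses DISCHARGED: `hL` by item 1, and `hA` is only ever used at `U = univ` on a bounded flow, where velocity AND
   pressure analyticity are tree theorems (`CentreJet.analyticOnNhd_of_isSteadyNSOn_univ` / `…_pressure_…` after the `C² → C³` upgrade
   `centreJet_isSteadyNSOn_of_bounded` that analyticity provides — import-never-restate).  The general-`U` interior-analyticity Prop `SteadyNSAnalytic` stays a typed hypothesis of the card (not claimed).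
3. The sketch's W1 glue re-proved over the twin names (pure logic, verbatim arguments): `octahedral_fixesNoVector`,
   `symmetricLiouville_of_poloidalLiouville`, `not_poloidalLiouville_of_symmetricCounterexample`, the octahedral instances, and
   `octahedralVorticalGerm_iff_not`.

HONEST LABEL: card-local kernel wiring strictly below the wall.  `OctahedralCentreRigidity` (the sieve's conjecture) is NOT touched and is
the ONE remaining hypothesis of the steady octahedral stratum; `SymmetricPoloidalLiouville`, `PoloidalLiouville` (1222), `UnthreadedRigidity`
(27585) and NS regularity are OPEN; information-grade (W1 movement 0).
[cite: KochNadirashviliSereginSverak2009, Lemma 3.1 (arXiv p. 7)] [cite: LemarieRieusset2016, proof of Thm. 15.4, Step 3 (p. 569)]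
-/

-- the summit and its single sub-problem share the name (CONVENTIONS §1)
set_option linter.dupNamespace false

noncomputable section

open Set Function Filter Metric
open scoped RealInnerProductSpace Topology
open Literature.Analysis.FluidPDE
open Summit.NavierStokesRegularity.NavierStokesRegularity.Theses
open Summit.NavierStokesRegularity.NavierStokesRegularity.Theorems.PoloidalLiouville.CentreJet (E3)

namespace Summit.NavierStokesRegularity.NavierStokesRegularity.Theorems.PoloidalLiouville.Platonic

/-! ### The sketch's light steady class on `ℝ³`, bounded, upgrades to `CentreJet`'s class -/

/-- **Upgrade.**  A BOUNDED flow of the sketch's `C²/C¹` class on `ℝ³` is a flow of `CentreJet`'s `C³` class: as a tree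
`IsSteadyNSSolution 1 0` it is real-analytic (`IsSteadyNSSolution.analyticOnNhd_of_bounded`: Oseen-mild + the local analytic Oseen
solution), hence `C³`.  Through this bridge every `CentreJet.*_of_isSteadyNSOn_univ` fact of the tree applies to the sketch's class
(import-never-restate). -/
theorem centreJet_isSteadyNSOn_of_bounded {V : E3 → E3} {p : E3 → ℝ} (h : IsSteadyNSOn univ V p)
    (hB : ∃ B : ℝ, ∀ x, ‖V x‖ ≤ B) : CentreJet.IsSteadyNSOn univ V p := by
  obtain ⟨B, hBV⟩ := hB
  have hsol : IsSteadyNSSolution 1 0 V p :=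
    { contDiff_velocity := contDiffOn_univ.1 h.1
      contDiff_pressure := contDiffOn_univ.1 h.2.1
      momentum := fun y => by
        have h4 := h.2.2.2 y (mem_univ y)
        rw [convect_apply, one_smul, Pi.zero_apply, ← h4]
        abel
      divFree := fun y => h.2.2.1 y (mem_univ y) }
  exact ⟨(hsol.analyticOnNhd_of_bounded hBV).contDiffOn_of_completeSpace, h.2.1, h.2.2.1, h.2.2.2⟩

/-! ### ★ `IrrotationalGermLiouville` BY NAME -/

/-- If the vorticity of a bounded classical steady flow on `ℝ³` vanishes on a ball about `0`, it vanishes identically. -/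
theorem curl_eq_zero_of_ball {V : E3 → E3} {p : E3 → ℝ} (h : IsSteadyNSOn univ V p) (hB : ∃ B : ℝ, ∀ x, ‖V x‖ ≤ B)
    {ρ : ℝ} (hρ : 0 < ρ) (h0 : ∀ x ∈ ball (0 : E3) ρ, curl V x = 0) (x : E3) : curl V x = 0 :=
  curl_eq_zero_of_eqOn_open (CentreJet.analyticOnNhd_of_isSteadyNSOn_univ (centreJet_isSteadyNSOn_of_bounded h hB) hB)
    isOpen_ball ⟨0, mem_ball_self hρ⟩ h0 x

/-- ★ **`IrrotationalGermLiouville` (sketch, verbatim body) is a THEOREM**: a bounded classical steady NS flow on `ℝ³` that is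
irrotational on some ball about `0` is constant.  Proof: analyticity of bounded steady flows (tree), identity theorem for `curl V`,
then KNSS Lemma 3.1 (`curl V = 0`, `div V = 0`, bounded ⇒ constant).  The momentum equation enters only through analyticity. -/
theorem irrotationalGermLiouville : IrrotationalGermLiouville := by
  intro V p hNS hB hball
  obtain ⟨ρ, hρ, h0⟩ := hball
  have hcurl : ∀ x, curl V x = 0 := curl_eq_zero_of_ball hNS hB hρ h0
  have hV2 : ContDiff ℝ 2 V := contDiffOn_univ.1 hNS.1
  have hdf : VectorCalculus.IsDivFree V := fun x => hNS.2.2.1 x (mem_univ x)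
  obtain ⟨B, hBV⟩ := hB
  exact ⟨V 0, fun x => eq_of_curl_eq_zero_of_isDivFree_of_bounded hV2 hcurl hdf hBV x 0⟩

/-! ### The octahedral group fixes no vector (sketch's kernel glue, over the twin names) -/

/-- O fixes no nonzero vector (the half-turns `diag(1,−1,−1)` and `diag(−1,−1,1)` already do it). -/
theorem octahedral_fixesNoVector : FixesNoVector octahedral := by
  intro b hb
  have d1 : IsCubeRotationData 1 ![1, -1, -1] :=
    ⟨by intro i; fin_cases i <;> simp, by simp [Fin.prod_univ_three]⟩
  have d2 : IsCubeRotationData 1 ![-1, -1, 1] :=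
    ⟨by intro i; fin_cases i <;> simp, by simp [Fin.prod_univ_three]⟩
  have h1 := hb _ ⟨1, ![1, -1, -1], d1, rfl⟩
  have h2 := hb _ ⟨1, ![-1, -1, 1], d2, rfl⟩
  have e0 := congrArg (fun v : E3 => v 0) h2
  have e1 := congrArg (fun v : E3 => v 1) h1
  have e2 := congrArg (fun v : E3 => v 2) h1
  simp [cubeRot] at e0 e1 e2
  ext i
  fin_cases i <;> simp <;> linarith

/-! ### W1 in a symmetry class (sketch's kernel glue, over the twin names) -/

/-- KERNEL GLUE: W1 ⇒ W1|_G with conclusion `v ≡ 0`, for any `G` fixing no vector. -/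
theorem symmetricLiouville_of_poloidalLiouville (G : Set (E3 → E3)) (hG : FixesNoVector G)
    (h : ThreadingFlux.PoloidalLiouville) : SymmetricPoloidalLiouville G := by
  intro v hv hmeas hsm hunthr hequi t ht x
  have hx0 : ∃ x₀ : E3, ∀ t < 0, ∀ x, inner ℝ (x - x₀) (curl (v t) x) = 0 :=
    ⟨0, fun t ht x => by simpa using hunthr t ht x⟩
  obtain ⟨b, hb⟩ := h v hv hmeas hsm hx0 t ht
  have hfix : ∀ g ∈ G, g b = b := by
    intro g hg
    have := hequi t ht g hg x
    rw [hb (g x), hb x] at this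
    exact this.symm
  rw [hb x, hG b hfix]

/-- KERNEL: a `G`-symmetric counterexample refutes W1 (for `G` fixing no vector). -/
theorem not_poloidalLiouville_of_symmetricCounterexample (G : Set (E3 → E3)) (hG : FixesNoVector G)
    (hc : SymmetricCounterexample G) : ¬ ThreadingFlux.PoloidalLiouville := by
  intro h
  obtain ⟨v, hv, hmeas, hsm, hunthr, hequi, t, ht, x, hx⟩ := hc
  exact hx (symmetricLiouville_of_poloidalLiouville G hG h v hv hmeas hsm hunthr hequi t ht x)

/-- The octahedral instance of the W1 glue. -/
theorem octahedralLiouville_of_poloidalLiouville (h : ThreadingFlux.PoloidalLiouville) :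
    SymmetricPoloidalLiouville octahedral :=
  symmetricLiouville_of_poloidalLiouville _ octahedral_fixesNoVector h

/-- The octahedral instance of the negation home: an O-symmetric counterexample refutes W1. -/
theorem not_poloidalLiouville_of_octahedralCounterexample (hc : SymmetricCounterexample octahedral) :
    ¬ ThreadingFlux.PoloidalLiouville :=
  not_poloidalLiouville_of_symmetricCounterexample _ octahedral_fixesNoVector hc

/-- The sieve's two typed outcomes are each other's negation. -/
theorem octahedralVorticalGerm_iff_not : OctahedralVorticalGerm ↔ ¬ OctahedralCentreRigidity := by
  constructor
  · rintro ⟨V, p, ρ, hρ, hV, hp, hNS, hun, heq, x, hx, hne⟩ h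
    exact hne (h V p ρ hρ hV hp hNS hun heq x hx)
  · intro h
    by_contra hc
    apply h
    intro V p ρ hρ hV hp hNS hun heq x hx
    by_contra hne
    exact hc ⟨V, p, ρ, hρ, hV, hp, hNS, hun, heq, x, hx, hne⟩

/-! ### ★ The steady octahedral stratum from the sieve's conjecture ALONE -/

/-- ★ **The sieve's conjecture decides the steady octahedral stratum of W1, with no further hypothesis**: if every real-analytic
steady NS germ about `0` that is unthreaded about `0` and O-equivariant is irrotational (`OctahedralCentreRigidity`), then every BOUNDED
classical steady NS flow on `ℝ³` that is unthreaded about `0` and O-equivariant vanishes identically.  (The sketch's rung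
`octahedralSteadyLiouville_of_centreRigidity` with its two classical hypotheses discharged: analyticity of velocity and pressure of a
bounded steady flow on `ℝ³` is in the tree, and `IrrotationalGermLiouville` is `irrotationalGermLiouville` above.) -/
theorem symmetricSteadyLiouville_octahedral_of_centreRigidity (hR : OctahedralCentreRigidity) :
    SymmetricSteadyLiouville octahedral := by
  intro V p hNS hB hun heq x
  have h3 : CentreJet.IsSteadyNSOn univ V p := centreJet_isSteadyNSOn_of_bounded hNS hB
  have hV : AnalyticOnNhd ℝ V univ := CentreJet.analyticOnNhd_of_isSteadyNSOn_univ h3 hB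
  have hp : AnalyticOnNhd ℝ p univ := CentreJet.analyticOnNhd_pressure_of_isSteadyNSOn_univ h3 hB
  have hNS1 : IsSteadyNSOn (ball (0 : E3) 1) V p :=
    ⟨hNS.1.mono (subset_univ _), hNS.2.1.mono (subset_univ _), fun y _ => hNS.2.2.1 y (mem_univ y),
      fun y _ => hNS.2.2.2 y (mem_univ y)⟩
  have hcurl : ∀ y ∈ ball (0 : E3) 1, curl V y = 0 :=
    hR V p 1 one_pos (hV.mono (subset_univ _)) (hp.mono (subset_univ _)) hNS1
      (fun y _ => hun y) (fun y _ σ s hd _ => heq _ ⟨σ, s, hd, rfl⟩ y)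
  obtain ⟨b, hb⟩ := irrotationalGermLiouville V p hNS hB ⟨1, one_pos, hcurl⟩
  have hfix : ∀ g ∈ octahedral, g b = b := by
    intro g hg
    have := heq g hg x
    rw [hb (g x), hb x] at this
    exact this.symm
  rw [hb x, octahedral_fixesNoVector b hfix]

/-- The same with a general point group: for ANY `G` fixing no vector, a germ-rigidity statement in the class (every bounded steady
unthreaded `G`-equivariant flow on `ℝ³` is irrotational near `0`) gives the steady `G`-stratum of W1. -/
theorem symmetricSteadyLiouville_of_irrotational_germs (G : Set (E3 → E3)) (hG : FixesNoVector G)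
    (hR : ∀ (V : E3 → E3) (p : E3 → ℝ), IsSteadyNSOn univ V p → (∃ B : ℝ, ∀ x, ‖V x‖ ≤ B) →
      (∀ x, inner ℝ x (curl V x) = 0) → IsEquivariant G V → ∃ ρ : ℝ, 0 < ρ ∧ ∀ x ∈ ball (0 : E3) ρ, curl V x = 0) :
    SymmetricSteadyLiouville G := by
  intro V p hNS hB hun heq x
  obtain ⟨b, hb⟩ := irrotationalGermLiouville V p hNS hB (hR V p hNS hB hun heq)
  have hfix : ∀ g ∈ G, g b = b := by
    intro g hg
    have := heq g hg x
    rw [hb (g x), hb x] at this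
    exact this.symm
  rw [hb x, hG b hfix]

end Summit.NavierStokesRegularity.NavierStokesRegularity.Theorems.PoloidalLiouville.Platonic

end
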